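import Literature.AlgebraicGeometry.Modules.AdaptedFrame
import HarnessLib

/-!
# Local endomorphisms of an `𝒪_X`-module given by matrices in a frame

For an `𝒪_X`-module `E` on a scheme `X`, a frame `e : 𝒪^I ≅ E|_W` (`I` finite) and an open `V ≤ W`
(`k : V ⟶ W`), a square matrix `A ∈ M_I(Γ(X, V))` defines the endomorphism

  `matrixEnd e k A : E|_V → E|_V`,  `b_l|_V ↦ Σ_m A_{ml} b_m|_V`

(so that `A` acts on coordinate columns: `λ(A·s) = A λ(s)`, `coordVec_appLE_matrixEnd`). This is the
dictionary between Čech cochains of `𝓔nd(E)` written as matrices in local frames and frame-free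
local homomorphisms. Proved: additivity (`matrixEnd_add`, `_zero`, `_sub`, `_neg`, `_zsmul`,
`_sum`), `matrixEnd 1 = 𝟙`, composition `matrixEnd B ≫ matrixEnd A = matrixEnd (A * B)`,
injectivity (`matrixEnd_injective`), restriction to smaller opens (`restrictHom_matrixEnd`), and the
**change of frame** `matrixEnd e' A' = matrixEnd e (T A' T')` for `T = T(e, e')`, `T' = T(e', e)`
(`matrixEnd_changeFrame`; Hartshorne II.5, change of basis), via the change-of-coordinates formula
`λ_e(s) = T(e,e') λ_{e'}(s)` (`coordVec_eq_transition_mulVec`). Everything is proved; no named facts.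

## References

* R. Hartshorne, *Algebraic Geometry*, GTM 52 (1977), II.5 (p. 109). [Hartshorne1977]
-/

noncomputable section

open CategoryTheory AlgebraicGeometry Opposite TopologicalSpace Limits

namespace Literature.AlgebraicGeometry.Modules

open Literature.AlgebraicGeometry.Motives

universe u

variable {X : Scheme.{u}} {E : X.Modules} {W W' V V' : X.Opens} {I I' : Type u}

/-! ### Coordinate vectors and change of coordinates -/

section Coord

variable [Fintype I] [Fintype I'] (e : SheafOfModules.free I ≅ E.over W)
  (e' : SheafOfModules.free I' ≅ E.over W')

/-- The coordinate vector `λ(s) = (λ_i(s))_i` of a section `s` over `V ≤ W` in the frame `e`.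
[folklore] -/
def coordVec (k : V ⟶ W) (s : Γ(E, V)) : I → Γ(X, V) := fun i => coord e k s i

omit [Fintype I] in
/-- Entries of the coordinate vector. [folklore] -/
@[simp] lemma coordVec_apply (k : V ⟶ W) (s : Γ(E, V)) (i : I) : coordVec e k s i = coord e k s i :=
  rfl

/-- Sections with equal coordinate vectors are equal. [folklore] -/
lemma ext_of_coordVec (k : V ⟶ W) {s t : Γ(E, V)} (h : coordVec e k s = coordVec e k t) : s = t :=
  ext_of_coord e k fun i => congrFun h i

/-- **Change of coordinates**: `λ^e(s) = T(e,e') λ^{e'}(s)` for a section `s` over `V ≤ W ⊓ W'`.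
[cite: Hartshorne1977, II.5 (p. 109)] -/
theorem coordVec_eq_transition_mulVec (k : V ⟶ W) (k' : V ⟶ W') (s : Γ(E, V)) :
    coordVec e k s = (transition e e' k k').mulVec (coordVec e' k' s) := by
  funext i
  rw [coordVec_apply, Matrix.mulVec, dotProduct]
  conv_lhs => rw [eq_sum_coord_smul e' k' s, coord_sum]
  refine Finset.sum_congr rfl fun j _ => ?_
  rw [coord_smul, map_basisSection_eq_sum_transition e e' k k' j, coord_sum_smul_basisSection,
    mul_comm, coordVec_apply]

end Coord

/-! ### The endomorphism defined by a matrix in a frame -/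

section MatrixEnd

variable [Fintype I] (e : SheafOfModules.free I ≅ E.over W)

/-- **The endomorphism of `E|_V` with matrix `A` in the frame `e` of `E|_W`** (`V ≤ W`):
`b_l|_V ↦ Σ_m A_{ml} b_m|_V`. [folklore] -/
def matrixEnd (k : V ⟶ W) (A : Matrix I I Γ(X, V)) : E.over V ⟶ E.over V :=
  homOfBasisValues (SheafOfModules.restrictTrivialisation (R := X.ringCatSheaf) k e)
    (fun l => ∑ m, A m l • E.presheaf.map k.op (basisSection e m))

/-- `matrixEnd A` on the restricted basis sections. [folklore] -/
lemma appLE_matrixEnd_basisSection (k : V ⟶ W) (A : Matrix I I Γ(X, V)) (l : I) :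
    appLE (matrixEnd e k A) (𝟙 V) (E.presheaf.map k.op (basisSection e l)) =
      ∑ m, A m l • E.presheaf.map k.op (basisSection e m) := by
  rw [← basisSection_restrictTrivialisation k e l, matrixEnd, appLE_homOfBasisValues]

/-- A value over `V'` of a morphism defined over `V` is the restriction of its value over `V`.
[folklore] -/
lemma appLE_eq_map_appLE_id {M : X.Modules} (χ : E.over V ⟶ M.over V) (l : V' ⟶ V) (s : Γ(E, V)) :
    appLE χ l (E.presheaf.map l.op s) = M.presheaf.map l.op (appLE χ (𝟙 V) s) := by
  rw [← appLE_map χ (𝟙 V) l s, Category.comp_id]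

/-- `matrixEnd A` on the basis sections restricted to `V' ≤ V`. [folklore] -/
lemma appLE_matrixEnd_basisSection' (k : V ⟶ W) (A : Matrix I I Γ(X, V)) (l : V' ⟶ V) (x : I) :
    appLE (matrixEnd e k A) l (E.presheaf.map l.op (E.presheaf.map k.op (basisSection e x))) =
      ∑ n, X.presheaf.map l.op (A n x) • E.presheaf.map (l ≫ k).op (basisSection e n) := by
  rw [appLE_eq_map_appLE_id, appLE_matrixEnd_basisSection, map_sum]
  refine Finset.sum_congr rfl fun n _ => ?_
  rw [Scheme.Modules.map_smul, presheaf_map_map]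

/-- **Coordinates of `A·s`**: `λ(A s) = A|_{V'} λ(s)` for `s ∈ Γ(E, V')`, `V' ≤ V`. [folklore] -/
theorem coordVec_appLE_matrixEnd (k : V ⟶ W) (A : Matrix I I Γ(X, V)) (l : V' ⟶ V)
    (s : Γ(E, V')) :
    coordVec e (l ≫ k) (appLE (matrixEnd e k A) l s) =
      (A.map (X.presheaf.map l.op).hom).mulVec (coordVec e (l ≫ k) s) := by
  classical
  funext m
  have hexp := appLE_eq_sum_coord (SheafOfModules.restrictTrivialisation (R := X.ringCatSheaf) k e)
    (matrixEnd e k A) l s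
  simp only [coord_restrictTrivialisation, basisSection_restrictTrivialisation,
    appLE_matrixEnd_basisSection'] at hexp
  rw [coordVec_apply, hexp, coord_sum, Matrix.mulVec, dotProduct]
  refine Finset.sum_congr rfl fun x _ => ?_
  rw [coord_smul, coord_sum, Matrix.map_apply, coordVec_apply, mul_comm]
  congr 1
  simp only [coord_smul, coord_map_basisSection, mul_ite, mul_one, mul_zero]
  rw [Finset.sum_ite_eq', if_pos (Finset.mem_univ _)]

/-- **`matrixEnd` is additive.** [folklore] -/
theorem matrixEnd_add (k : V ⟶ W) (A B : Matrix I I Γ(X, V)) :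
    matrixEnd e k (A + B) = matrixEnd e k A + matrixEnd e k B := by
  refine hom_ext_of_appLE fun V' l s => ext_of_coordVec e (l ≫ k) ?_
  have h : coordVec e (l ≫ k) (appLE (matrixEnd e k A + matrixEnd e k B) l s) =
      coordVec e (l ≫ k) (appLE (matrixEnd e k A) l s) + coordVec e (l ≫ k) (appLE (matrixEnd e k B) l s) := by
    funext m; exact coord_add e (l ≫ k) _ _ m
  rw [h, coordVec_appLE_matrixEnd, coordVec_appLE_matrixEnd, coordVec_appLE_matrixEnd,
    ← Matrix.add_mulVec]
  congr 1
  ext a b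
  exact map_add (X.presheaf.map l.op).hom (A a b) (B a b)

/-- `matrixEnd 0 = 0`. [folklore] -/
theorem matrixEnd_zero (k : V ⟶ W) : matrixEnd e k (0 : Matrix I I Γ(X, V)) = 0 := by
  refine hom_ext_of_appLE fun V' l s => ext_of_coordVec e (l ≫ k) ?_
  have h : coordVec e (l ≫ k) (appLE (0 : E.over V ⟶ E.over V) l s) = 0 := by
    funext m; exact coord_zero e (l ≫ k) m
  rw [h, coordVec_appLE_matrixEnd, Matrix.map_zero _ (map_zero _), Matrix.zero_mulVec]

/-- The matrices-to-endomorphisms map as an additive homomorphism. [folklore] -/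
def matrixEndHom (k : V ⟶ W) : Matrix I I Γ(X, V) →+ (E.over V ⟶ E.over V) where
  toFun := matrixEnd e k
  map_zero' := matrixEnd_zero e k
  map_add' := matrixEnd_add e k

/-- `matrixEnd (A - B) = matrixEnd A - matrixEnd B`. [folklore] -/
theorem matrixEnd_sub (k : V ⟶ W) (A B : Matrix I I Γ(X, V)) :
    matrixEnd e k (A - B) = matrixEnd e k A - matrixEnd e k B :=
  map_sub (matrixEndHom e k) A B

/-- `matrixEnd (-A) = -matrixEnd A`. [folklore] -/
theorem matrixEnd_neg (k : V ⟶ W) (A : Matrix I I Γ(X, V)) :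
    matrixEnd e k (-A) = -matrixEnd e k A :=
  map_neg (matrixEndHom e k) A

/-- `matrixEnd (n • A) = n • matrixEnd A` for `n : ℤ`. [folklore] -/
theorem matrixEnd_zsmul (k : V ⟶ W) (n : ℤ) (A : Matrix I I Γ(X, V)) :
    matrixEnd e k (n • A) = n • matrixEnd e k A :=
  map_zsmul (matrixEndHom e k) n A

/-- `matrixEnd` of a finite sum. [folklore] -/
theorem matrixEnd_sum (k : V ⟶ W) {κ : Type*} (t : Finset κ) (A : κ → Matrix I I Γ(X, V)) :
    matrixEnd e k (∑ c ∈ t, A c) = ∑ c ∈ t, matrixEnd e k (A c) :=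
  map_sum (matrixEndHom e k) A t

/-- **`matrixEnd 1 = 𝟙`.** [folklore] -/
theorem matrixEnd_one [DecidableEq I] (k : V ⟶ W) : matrixEnd e k (1 : Matrix I I Γ(X, V)) = 𝟙 _ := by
  refine hom_ext_of_appLE fun V' l s => ext_of_coordVec e (l ≫ k) ?_
  rw [coordVec_appLE_matrixEnd, Matrix.map_one _ (map_zero _) (map_one _), Matrix.one_mulVec,
    appLE_id]

/-- **Composition**: `matrixEnd B ≫ matrixEnd A = matrixEnd (A * B)` (matrices act on coordinate
columns). [folklore] -/
theorem matrixEnd_comp (k : V ⟶ W) (A B : Matrix I I Γ(X, V)) :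
    matrixEnd e k B ≫ matrixEnd e k A = matrixEnd e k (A * B) := by
  refine hom_ext_of_appLE fun V' l s => ext_of_coordVec e (l ≫ k) ?_
  rw [appLE_comp, coordVec_appLE_matrixEnd, coordVec_appLE_matrixEnd, coordVec_appLE_matrixEnd,
    Matrix.mulVec_mulVec, Matrix.map_mul]

omit [Fintype I] in
/-- Coordinates of the restricted basis sections form the standard basis vectors. [folklore] -/
lemma coordVec_map_basisSection [DecidableEq I] (k : V ⟶ W) (l : I) :
    coordVec e k (E.presheaf.map k.op (basisSection e l)) = Pi.single l 1 := by
  funext m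
  rw [coordVec_apply, coord_map_basisSection, Pi.single_apply]
  exact if_congr eq_comm rfl rfl

/-- **`matrixEnd` is injective**: the matrix is recovered from the values on the basis.
[folklore] -/
theorem matrixEnd_injective (k : V ⟶ W) : Function.Injective (matrixEnd e k) := by
  classical
  intro A B h
  ext m l
  have h1 := congrArg (fun χ => coordVec e (𝟙 V ≫ k) (appLE χ (𝟙 V)
    (E.presheaf.map (𝟙 V ≫ k).op (basisSection e l))) m) h
  simp only [coordVec_appLE_matrixEnd, coordVec_map_basisSection, Matrix.mulVec, dotProduct,
    Pi.single_apply, mul_ite, mul_one, mul_zero, Finset.sum_ite_eq', Finset.mem_univ, if_true,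
    Matrix.map_apply, op_id, CategoryTheory.Functor.map_id, CommRingCat.hom_id, RingHom.id_apply] at h1
  exact h1

/-- **Restriction**: `(matrixEnd A)|_{V'} = matrixEnd (A|_{V'})`. [folklore] -/
theorem restrictHom_matrixEnd (k : V ⟶ W) (l : V' ⟶ V) (A : Matrix I I Γ(X, V)) :
    restrictHom l (matrixEnd e k A) = matrixEnd e (l ≫ k) (A.map (X.presheaf.map l.op).hom) := by
  refine hom_ext_of_appLE fun V'' l' s => ext_of_coordVec e (l' ≫ l ≫ k) ?_
  rw [appLE_restrictHom]
  have h1 := coordVec_appLE_matrixEnd e k A (l' ≫ l) s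
  rw [Category.assoc] at h1
  rw [h1, coordVec_appLE_matrixEnd, Matrix.map_map]
  congr 2
  funext a
  change X.presheaf.map (l' ≫ l).op a = X.presheaf.map l'.op (X.presheaf.map l.op a)
  rw [op_comp, Functor.map_comp]
  rfl

end MatrixEnd

/-! ### Change of frame -/

section ChangeFrame

variable [Fintype I] [Fintype I']
  (e : SheafOfModules.free I ≅ E.over W) (e' : SheafOfModules.free I' ≅ E.over W')

/-- **Change of frame**: over `V ≤ W ⊓ W'`, the endomorphism with matrix `A'` in the frame `e'` has
matrix `T(e,e') A' T(e',e)` in the frame `e`. [cite: Hartshorne1977, II.5 (p. 109)] -/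
theorem matrixEnd_changeFrame (k : V ⟶ W) (k' : V ⟶ W') (A' : Matrix I' I' Γ(X, V)) :
    matrixEnd e' k' A' = matrixEnd e k (transition e e' k k' * A' * transition e' e k' k) := by
  refine hom_ext_of_appLE fun V'' l s => ext_of_coordVec e (l ≫ k) ?_
  rw [coordVec_appLE_matrixEnd, Matrix.map_mul, Matrix.map_mul, transition_map,
    transition_map, coordVec_eq_transition_mulVec e e' (l ≫ k) (l ≫ k'),
    coordVec_appLE_matrixEnd, coordVec_eq_transition_mulVec e' e (l ≫ k') (l ≫ k) s,
    Matrix.mulVec_mulVec, Matrix.mulVec_mulVec]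

end ChangeFrame

end Literature.AlgebraicGeometry.Modules

end
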